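import Summits.ValiantsHypothesis.ValiantsHypothesis.Theorems.KPlusLogSqLawTropicalCycleMonotone

/-!
# Route «KPlusLogSqLaw», crux `TropicalB` (stmt-ValiantsHypothesis-19771) — the FLOOR / CEILING HUB LAWS:
# a dominant term carrying the minimal exponent outside a column set `C` differs from EVERY earlier dominant term only on
# exchange orbits through `C` (one exceptional column ⇒ one cycle); dually for the maximal exponent and later terms

HONEST FRAMING.  Helper file (cell `pub-symmetroid`, seat val-sym-trop-p1 g30, 2026-08-29; `--supports stmt-ValiantsHypothesis-19771 --as helper`)
toward the registered stubs `stub_tropThin` / `stub_tropFat` of `Cruxes/TropicalB/Lines/birth.lean` (crux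
`Summit.ValiantsHypothesis.ValiantsHypothesis.Theses.KPlusLogSqLaw.TropicalB`, item stmt-ValiantsHypothesis-19771, route KPlusLogSqLaw).
A STRUCTURE law about pairs of unique optima (`IsDominant` of `…MatrixDescartesFalseOfTropicalMonster`) of an ARBITRARY dominance design,
every format, arbitrary exponents, valuations, signs and support; it is a corollary of the cyclewise monotonicity law
`sum_d_lt_of_isDominant_invariant` (…TropicalCycleMonotone).  It bounds nothing: `TropicalB` stays OPEN; nothing here bears on `TropicalB`
in its window, `WeakLifting`, DoorA26 / DoorA34, `MatrixDescartes` (stmt-ValiantsHypothesis-18050) or VP ≠ VNP.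

THE LAWS.  Let `x = (σ₁, λ₁)` be dominant at `θ₁` and `y = (σ₂, λ₂)` at `θ₂ > θ₁`; `q = σ₁⁻¹σ₂` the exchange quotient.
* §1 `agree_of_floor` — FLOOR LAW (invariant-set form): if on a `q`-invariant column set `T` the LATER term `y` carries in every column a
  class of minimal exponent (`d (λ₂ b) ≤ d l` for all `l`), then `x` and `y` agree on `T` (rows and classes): the exponent mass of `y` on `T`
  cannot exceed that of `x`, so the cyclewise law forbids any difference.  `agree_of_ceiling` — CEILING LAW: the same if the EARLIER term `x`
  carries a class of maximal exponent in every column of `T`.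
* §2 `sameCycle_of_floor` — orbit form: if `y` carries a minimal-exponent class in every column outside a set `C`, then every column where
  `x` and `y` differ lies in the `q`-orbit of a column of `C` (so they differ on at most `#C` exchange orbits).  `sameCycle_of_floor_single` /
  `isCycle_or_eq_of_floor_single` — ONE exceptional column `c` (a «hub» term: one token, all other columns on the exponent floor — e.g. the
  first state of a new digit of any odometer-type chain, the single-token states of the tree's binary counters …TropicalBBinaryCounters /
  …BinaryCounterSix): every earlier dominant term differs from `y` exactly along ONE cycle through `c` (`σ₁⁻¹σ₂` is a cycle containing `c`
  and every changed column), or has the same permutation and differs from `y` at most in the class of column `c`.  Ceiling duals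
  `sameCycle_of_ceiling`, `isCycle_or_eq_of_ceiling_single` (one column below the exponent ceiling ⇒ every LATER term is one cycle away).
* §3 chain forms: `hub_chain_earlier` (a floor hub at position `j` of a dominant chain is one cycle away from every earlier term) and
  `hub_chain_pairwise` (the floor hubs of a chain have pairwise single-cycle-or-trivial permutation quotients — they form a family of the
  kind studied in …TropicalBSingleCycleQuotients, whatever the design).
READING (located use, not a theorem about the census): for constructions, a state with ONE token is linked to ALL earlier states by single
cycles through the token's column, and a state with `t` tokens meets every earlier state on at most `t` exchange orbits; for the (β) question
(visited images) a hub's column set images differ from an earlier term's only along one cycle.  [this cell's law; the exchange argument is folklore]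
-/

set_option linter.dupNamespace false
set_option autoImplicit false

namespace Summit.ValiantsHypothesis.ValiantsHypothesis.Theorems.KPlusLogSqLaw.FloorHub

open Summit.ValiantsHypothesis.ValiantsHypothesis.Theorems.MatrixDescartes.Negative
open Summit.ValiantsHypothesis.ValiantsHypothesis.Theorems.KPlusLogSqLaw
open scoped BigOperators

variable {m K : ℕ}

/-! ## §1 Floor and ceiling laws on an invariant column set -/

/-- **Floor law.**  `x = (σ₁, λ₁)` dominant at `θ₁`, `y = (σ₂, λ₂)` dominant at `θ₂ > θ₁`, `T` invariant under `σ₁⁻¹σ₂`.  If the later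
term carries a class of minimal exponent in every column of `T`, the two terms agree on `T`. [this cell's law] -/
theorem agree_of_floor (d : Fin K → ℕ) (v ε : Fin m → Fin m → Fin K → ℤ) {θ₁ θ₂ : ℤ} (hθ : θ₁ < θ₂)
    {σ₁ σ₂ : Equiv.Perm (Fin m)} {l₁ l₂ : Fin m → Fin K}
    (h₁ : IsDominant d v ε θ₁ (σ₁, l₁)) (h₂ : IsDominant d v ε θ₂ (σ₂, l₂)) (T : Finset (Fin m))
    (hT : ∀ b, (σ₁⁻¹ * σ₂) b ∈ T ↔ b ∈ T) (hfloor : ∀ b ∈ T, ∀ l : Fin K, d (l₂ b) ≤ d l) :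
    ∀ b ∈ T, σ₁ b = σ₂ b ∧ l₁ b = l₂ b := by
  by_contra hcon
  push Not at hcon
  obtain ⟨b, hb, hne⟩ := hcon
  have hne' : ∃ b ∈ T, σ₁ b ≠ σ₂ b ∨ l₁ b ≠ l₂ b := by
    refine ⟨b, hb, ?_⟩
    by_cases h : σ₁ b = σ₂ b
    · exact Or.inr (hne h)
    · exact Or.inl h
  have hlt := sum_d_lt_of_isDominant_invariant d v ε hθ h₁ h₂ T hT hne'
  have hle : ∑ b ∈ T, (d (l₂ b) : ℤ) ≤ ∑ b ∈ T, (d (l₁ b) : ℤ) :=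
    Finset.sum_le_sum fun b hb => by exact_mod_cast hfloor b hb (l₁ b)
  exact absurd (lt_of_lt_of_le hlt hle) (lt_irrefl _)

/-- **Ceiling law.**  Same setting; if the EARLIER term carries a class of maximal exponent in every column of the invariant set `T`,
the two terms agree on `T`. [this cell's law] -/
theorem agree_of_ceiling (d : Fin K → ℕ) (v ε : Fin m → Fin m → Fin K → ℤ) {θ₁ θ₂ : ℤ} (hθ : θ₁ < θ₂)
    {σ₁ σ₂ : Equiv.Perm (Fin m)} {l₁ l₂ : Fin m → Fin K}
    (h₁ : IsDominant d v ε θ₁ (σ₁, l₁)) (h₂ : IsDominant d v ε θ₂ (σ₂, l₂)) (T : Finset (Fin m))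
    (hT : ∀ b, (σ₁⁻¹ * σ₂) b ∈ T ↔ b ∈ T) (hceil : ∀ b ∈ T, ∀ l : Fin K, d l ≤ d (l₁ b)) :
    ∀ b ∈ T, σ₁ b = σ₂ b ∧ l₁ b = l₂ b := by
  by_contra hcon
  push Not at hcon
  obtain ⟨b, hb, hne⟩ := hcon
  have hne' : ∃ b ∈ T, σ₁ b ≠ σ₂ b ∨ l₁ b ≠ l₂ b := by
    refine ⟨b, hb, ?_⟩
    by_cases h : σ₁ b = σ₂ b
    · exact Or.inr (hne h)
    · exact Or.inl h
  have hlt := sum_d_lt_of_isDominant_invariant d v ε hθ h₁ h₂ T hT hne'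
  have hle : ∑ b ∈ T, (d (l₂ b) : ℤ) ≤ ∑ b ∈ T, (d (l₁ b) : ℤ) :=
    Finset.sum_le_sum fun b hb => by exact_mod_cast hceil b hb (l₂ b)
  exact absurd (lt_of_lt_of_le hlt hle) (lt_irrefl _)

/-! ## §2 Orbit forms: all differences lie on exchange orbits through the exceptional columns -/

/-- the columns whose orbit under `q` avoids `C` form a `q`-invariant set disjoint from `C`. [elementary] -/
theorem invariant_avoid (q : Equiv.Perm (Fin m)) (C : Finset (Fin m)) (b : Fin m) :
    q b ∈ (Finset.univ.filter fun b' => ∀ c ∈ C, ¬ q.SameCycle b' c) ↔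
      b ∈ (Finset.univ.filter fun b' => ∀ c ∈ C, ¬ q.SameCycle b' c) := by
  simp only [Finset.mem_filter, Finset.mem_univ, true_and]
  constructor
  · intro h c hc hbc
    exact h c hc (Equiv.Perm.sameCycle_apply_left.mpr hbc)
  · intro h c hc hbc
    exact h c hc (Equiv.Perm.sameCycle_apply_left.mp hbc)

/-- **Floor law, orbit form.**  If the later dominant term `y = (σ₂, λ₂)` carries a class of minimal exponent in every column outside `C`,
then every column where an earlier dominant term `x = (σ₁, λ₁)` differs from `y` (in row or class) is in the `σ₁⁻¹σ₂`-orbit of some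
column of `C`. [this cell's law] -/
theorem sameCycle_of_floor (d : Fin K → ℕ) (v ε : Fin m → Fin m → Fin K → ℤ) {θ₁ θ₂ : ℤ} (hθ : θ₁ < θ₂)
    {σ₁ σ₂ : Equiv.Perm (Fin m)} {l₁ l₂ : Fin m → Fin K}
    (h₁ : IsDominant d v ε θ₁ (σ₁, l₁)) (h₂ : IsDominant d v ε θ₂ (σ₂, l₂)) (C : Finset (Fin m))
    (hfloor : ∀ b ∉ C, ∀ l : Fin K, d (l₂ b) ≤ d l) {b : Fin m} (hb : σ₁ b ≠ σ₂ b ∨ l₁ b ≠ l₂ b) :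
    ∃ c ∈ C, (σ₁⁻¹ * σ₂).SameCycle b c := by
  classical
  by_contra hcon
  push Not at hcon
  set T := Finset.univ.filter fun b' => ∀ c ∈ C, ¬ (σ₁⁻¹ * σ₂).SameCycle b' c with hTdef
  have hbT : b ∈ T := by simpa [hTdef] using hcon
  have hTC : ∀ b' ∈ T, b' ∉ C := by
    intro b' hb' hb'C
    have := (Finset.mem_filter.mp hb').2 b' hb'C
    exact this (Equiv.Perm.SameCycle.refl _ _)
  have hag := agree_of_floor d v ε hθ h₁ h₂ T (invariant_avoid (σ₁⁻¹ * σ₂) C)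
    (fun b' hb' l => hfloor b' (hTC b' hb') l) b hbT
  rcases hb with h | h
  · exact h hag.1
  · exact h hag.2

/-- **Ceiling law, orbit form.**  If the earlier dominant term `x` carries a class of maximal exponent in every column outside `C`, then every
column where a later dominant term `y` differs from `x` is in the `σ₁⁻¹σ₂`-orbit of some column of `C`. [this cell's law] -/
theorem sameCycle_of_ceiling (d : Fin K → ℕ) (v ε : Fin m → Fin m → Fin K → ℤ) {θ₁ θ₂ : ℤ} (hθ : θ₁ < θ₂)
    {σ₁ σ₂ : Equiv.Perm (Fin m)} {l₁ l₂ : Fin m → Fin K}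
    (h₁ : IsDominant d v ε θ₁ (σ₁, l₁)) (h₂ : IsDominant d v ε θ₂ (σ₂, l₂)) (C : Finset (Fin m))
    (hceil : ∀ b ∉ C, ∀ l : Fin K, d l ≤ d (l₁ b)) {b : Fin m} (hb : σ₁ b ≠ σ₂ b ∨ l₁ b ≠ l₂ b) :
    ∃ c ∈ C, (σ₁⁻¹ * σ₂).SameCycle b c := by
  classical
  by_contra hcon
  push Not at hcon
  set T := Finset.univ.filter fun b' => ∀ c ∈ C, ¬ (σ₁⁻¹ * σ₂).SameCycle b' c with hTdef
  have hbT : b ∈ T := by simpa [hTdef] using hcon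
  have hTC : ∀ b' ∈ T, b' ∉ C := by
    intro b' hb' hb'C
    have := (Finset.mem_filter.mp hb').2 b' hb'C
    exact this (Equiv.Perm.SameCycle.refl _ _)
  have hag := agree_of_ceiling d v ε hθ h₁ h₂ T (invariant_avoid (σ₁⁻¹ * σ₂) C)
    (fun b' hb' l => hceil b' (hTC b' hb') l) b hbT
  rcases hb with h | h
  · exact h hag.1
  · exact h hag.2

/-- **Floor hub, one exceptional column.**  If the later term carries a minimal-exponent class in every column except possibly `c`, then every
changed column is in the orbit of `c` under the exchange quotient. [this cell's law] -/
theorem sameCycle_of_floor_single (d : Fin K → ℕ) (v ε : Fin m → Fin m → Fin K → ℤ) {θ₁ θ₂ : ℤ} (hθ : θ₁ < θ₂)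
    {σ₁ σ₂ : Equiv.Perm (Fin m)} {l₁ l₂ : Fin m → Fin K}
    (h₁ : IsDominant d v ε θ₁ (σ₁, l₁)) (h₂ : IsDominant d v ε θ₂ (σ₂, l₂)) (c : Fin m)
    (hfloor : ∀ b, b ≠ c → ∀ l : Fin K, d (l₂ b) ≤ d l) {b : Fin m} (hb : σ₁ b ≠ σ₂ b ∨ l₁ b ≠ l₂ b) :
    (σ₁⁻¹ * σ₂).SameCycle b c := by
  obtain ⟨c', hc', h⟩ := sameCycle_of_floor d v ε hθ h₁ h₂ {c} (fun b hb => hfloor b (by simpa using hb)) hb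
  rw [Finset.mem_singleton] at hc'
  exact hc' ▸ h

/-- moved columns are changed columns: `(σ₁⁻¹σ₂) b ≠ b ↔ σ₁ b ≠ σ₂ b`. [elementary] -/
theorem quotient_ne_iff {σ₁ σ₂ : Equiv.Perm (Fin m)} (b : Fin m) : (σ₁⁻¹ * σ₂) b ≠ b ↔ σ₁ b ≠ σ₂ b := by
  rw [not_iff_not, Equiv.Perm.mul_apply, Equiv.Perm.inv_eq_iff_eq]
  exact eq_comm

/-- **One cycle or one class.**  Under the floor-hub hypothesis at column `c`: either the two permutations coincide and the terms differ
at most in the class of column `c`, or `σ₁⁻¹σ₂` is a single cycle, that cycle passes through `c`, and every changed column lies on it.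
[this cell's law] -/
theorem isCycle_or_eq_of_floor_single (d : Fin K → ℕ) (v ε : Fin m → Fin m → Fin K → ℤ) {θ₁ θ₂ : ℤ} (hθ : θ₁ < θ₂)
    {σ₁ σ₂ : Equiv.Perm (Fin m)} {l₁ l₂ : Fin m → Fin K}
    (h₁ : IsDominant d v ε θ₁ (σ₁, l₁)) (h₂ : IsDominant d v ε θ₂ (σ₂, l₂)) (c : Fin m)
    (hfloor : ∀ b, b ≠ c → ∀ l : Fin K, d (l₂ b) ≤ d l) :
    (σ₁ = σ₂ ∧ ∀ b, b ≠ c → l₁ b = l₂ b) ∨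
      ((σ₁⁻¹ * σ₂).IsCycle ∧ (σ₁⁻¹ * σ₂) c ≠ c ∧
        ∀ b, (σ₁ b ≠ σ₂ b ∨ l₁ b ≠ l₂ b) → (σ₁⁻¹ * σ₂).SameCycle c b) := by
  have key : ∀ b, (σ₁ b ≠ σ₂ b ∨ l₁ b ≠ l₂ b) → (σ₁⁻¹ * σ₂).SameCycle c b :=
    fun b hb => (sameCycle_of_floor_single d v ε hθ h₁ h₂ c hfloor hb).symm
  by_cases hσ : σ₁ = σ₂
  · left
    refine ⟨hσ, fun b hbc => ?_⟩
    by_contra hl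
    have hsc := key b (Or.inr hl)
    -- with `σ₁ = σ₂` the quotient is `1`, whose orbits are singletons
    rw [hσ, inv_mul_cancel, Equiv.Perm.sameCycle_one] at hsc
    exact hbc hsc.symm
  · right
    -- some column moves
    have hex : ∃ b, σ₁ b ≠ σ₂ b := by
      by_contra hall
      push Not at hall
      exact hσ (Equiv.ext hall)
    obtain ⟨b₀, hb₀⟩ := hex
    have hb₀q : (σ₁⁻¹ * σ₂) b₀ ≠ b₀ := (quotient_ne_iff b₀).mpr hb₀
    have hcb₀ : (σ₁⁻¹ * σ₂).SameCycle c b₀ := key b₀ (Or.inl hb₀)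
    have hcq : (σ₁⁻¹ * σ₂) c ≠ c := fun hfix => hb₀q ((hcb₀.apply_eq_self_iff).mp hfix)
    refine ⟨⟨c, hcq, fun y hy => key y (Or.inl ((quotient_ne_iff y).mp hy))⟩, hcq, key⟩

/-- **Ceiling hub, one exceptional column** (dual): if the EARLIER term carries a maximal-exponent class in every column except possibly `c`,
then every later dominant term has the same permutation (differing at most in the class of `c`) or differs from it along one cycle through `c`
carrying every changed column. [this cell's law] -/
theorem isCycle_or_eq_of_ceiling_single (d : Fin K → ℕ) (v ε : Fin m → Fin m → Fin K → ℤ) {θ₁ θ₂ : ℤ} (hθ : θ₁ < θ₂)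
    {σ₁ σ₂ : Equiv.Perm (Fin m)} {l₁ l₂ : Fin m → Fin K}
    (h₁ : IsDominant d v ε θ₁ (σ₁, l₁)) (h₂ : IsDominant d v ε θ₂ (σ₂, l₂)) (c : Fin m)
    (hceil : ∀ b, b ≠ c → ∀ l : Fin K, d l ≤ d (l₁ b)) :
    (σ₁ = σ₂ ∧ ∀ b, b ≠ c → l₁ b = l₂ b) ∨
      ((σ₁⁻¹ * σ₂).IsCycle ∧ (σ₁⁻¹ * σ₂) c ≠ c ∧
        ∀ b, (σ₁ b ≠ σ₂ b ∨ l₁ b ≠ l₂ b) → (σ₁⁻¹ * σ₂).SameCycle c b) := by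
  have key : ∀ b, (σ₁ b ≠ σ₂ b ∨ l₁ b ≠ l₂ b) → (σ₁⁻¹ * σ₂).SameCycle c b := by
    intro b hb
    obtain ⟨c', hc', h⟩ := sameCycle_of_ceiling d v ε hθ h₁ h₂ {c} (fun b' hb' => hceil b' (by simpa using hb')) hb
    rw [Finset.mem_singleton] at hc'
    exact (hc' ▸ h).symm
  by_cases hσ : σ₁ = σ₂
  · left
    refine ⟨hσ, fun b hbc => ?_⟩
    by_contra hl
    have hsc := key b (Or.inr hl)
    rw [hσ, inv_mul_cancel, Equiv.Perm.sameCycle_one] at hsc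
    exact hbc hsc.symm
  · right
    have hex : ∃ b, σ₁ b ≠ σ₂ b := by
      by_contra hall
      push Not at hall
      exact hσ (Equiv.ext hall)
    obtain ⟨b₀, hb₀⟩ := hex
    have hb₀q : (σ₁⁻¹ * σ₂) b₀ ≠ b₀ := (quotient_ne_iff b₀).mpr hb₀
    have hcb₀ : (σ₁⁻¹ * σ₂).SameCycle c b₀ := key b₀ (Or.inl hb₀)
    have hcq : (σ₁⁻¹ * σ₂) c ≠ c := fun hfix => hb₀q ((hcb₀.apply_eq_self_iff).mp hfix)
    refine ⟨⟨c, hcq, fun y hy => key y (Or.inl ((quotient_ne_iff y).mp hy))⟩, hcq, key⟩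

/-! ## §3 Chain forms: hubs of a dominant chain -/

/-- **Hubs see every earlier term along one cycle.**  In a dominant chain `p₀, …, pₙ` at strictly increasing slopes, if the term at position `j`
carries a minimal-exponent class in every column except `c`, then for every `i < j` the quotient `σᵢ⁻¹σⱼ` is `1` (and the terms differ at most in
the class of `c`) or a single cycle through `c` carrying every changed column. [this cell's law] -/
theorem hub_chain_earlier (d : Fin K → ℕ) (v ε : Fin m → Fin m → Fin K → ℤ) {n : ℕ} {θ : Fin (n + 1) → ℤ} (hθ : StrictMono θ)
    {p : Fin (n + 1) → Equiv.Perm (Fin m) × (Fin m → Fin K)} (hdom : ∀ k, IsDominant d v ε (θ k) (p k))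
    {i j : Fin (n + 1)} (hij : i < j) (c : Fin m) (hfloor : ∀ b, b ≠ c → ∀ l : Fin K, d ((p j).2 b) ≤ d l) :
    ((p i).1 = (p j).1 ∧ ∀ b, b ≠ c → (p i).2 b = (p j).2 b) ∨
      (((p i).1⁻¹ * (p j).1).IsCycle ∧ ((p i).1⁻¹ * (p j).1) c ≠ c ∧
        ∀ b, ((p i).1 b ≠ (p j).1 b ∨ (p i).2 b ≠ (p j).2 b) → ((p i).1⁻¹ * (p j).1).SameCycle c b) :=
  isCycle_or_eq_of_floor_single d v ε (hθ hij) (σ₁ := (p i).1) (σ₂ := (p j).1) (l₁ := (p i).2) (l₂ := (p j).2)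
    (hdom i) (hdom j) c hfloor

/-- **The hubs of a chain pairwise differ by single cycles.**  If the terms at positions `i < j` of a dominant chain are both floor hubs (exceptional
columns `cᵢ`, `cⱼ`), then `σᵢ⁻¹σⱼ` is `1` or a single cycle through `cⱼ`; in particular the hub permutations of any dominant chain of any design form
a family with pairwise single-cycle-or-trivial quotients (cf. …TropicalBSingleCycleQuotients). [this cell's law] -/
theorem hub_chain_pairwise (d : Fin K → ℕ) (v ε : Fin m → Fin m → Fin K → ℤ) {n : ℕ} {θ : Fin (n + 1) → ℤ} (hθ : StrictMono θ)
    {p : Fin (n + 1) → Equiv.Perm (Fin m) × (Fin m → Fin K)} (hdom : ∀ k, IsDominant d v ε (θ k) (p k))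
    (hub : Fin (n + 1) → Prop) (col : Fin (n + 1) → Fin m)
    (hhub : ∀ k, hub k → ∀ b, b ≠ col k → ∀ l : Fin K, d ((p k).2 b) ≤ d l)
    {i j : Fin (n + 1)} (hij : i < j) (_hi : hub i) (hj : hub j) :
    (p i).1 = (p j).1 ∨ (((p i).1⁻¹ * (p j).1).IsCycle ∧ ((p i).1⁻¹ * (p j).1) (col j) ≠ col j) := by
  rcases hub_chain_earlier d v ε hθ hdom hij (col j) (hhub j hj) with h | h
  · exact Or.inl h.1
  · exact Or.inr ⟨h.1, h.2.1⟩

/-! ## §4 (rev 2, same seat) Agreement on the exceptional columns forces equality; a hub's exceptional incidence is fresh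

If the later term is on the exponent floor off `C` and the two dominant terms AGREE on `C`, they are the same term: every column of `C` is
then a fixed point of the exchange quotient, so its orbit is a singleton, and by `sameCycle_of_floor` no column can differ.  Hence a floor
hub differs from every other earlier dominant term AT its exceptional column — the hub's exceptional incidence (row, column, class) is
carried by no earlier term of a chain («fresh token»); dually a ceiling hub's exceptional incidence is carried by no later term. -/

/-- **Equality from agreement on the exceptions (floor).**  Later term on the exponent floor off `C`, agreement on `C` ⇒ equal terms.
[this cell's law] -/
theorem eq_of_floor_agree (d : Fin K → ℕ) (v ε : Fin m → Fin m → Fin K → ℤ) {θ₁ θ₂ : ℤ} (hθ : θ₁ < θ₂)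
    {σ₁ σ₂ : Equiv.Perm (Fin m)} {l₁ l₂ : Fin m → Fin K}
    (h₁ : IsDominant d v ε θ₁ (σ₁, l₁)) (h₂ : IsDominant d v ε θ₂ (σ₂, l₂)) (C : Finset (Fin m))
    (hfloor : ∀ b ∉ C, ∀ l : Fin K, d (l₂ b) ≤ d l) (hagree : ∀ c ∈ C, σ₁ c = σ₂ c ∧ l₁ c = l₂ c) :
    σ₁ = σ₂ ∧ l₁ = l₂ := by
  have key : ∀ b, σ₁ b = σ₂ b ∧ l₁ b = l₂ b := by
    intro b
    by_contra hb
    have hb' : σ₁ b ≠ σ₂ b ∨ l₁ b ≠ l₂ b := by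
      by_cases h : σ₁ b = σ₂ b
      · exact Or.inr fun h' => hb ⟨h, h'⟩
      · exact Or.inl h
    obtain ⟨c, hc, hsc⟩ := sameCycle_of_floor d v ε hθ h₁ h₂ C hfloor hb'
    -- `c` is a fixed point of the quotient, so its orbit is `{c}`
    have hfix : Function.IsFixedPt (σ₁⁻¹ * σ₂) c := by
      show (σ₁⁻¹ * σ₂) c = c
      rw [Equiv.Perm.mul_apply, Equiv.Perm.inv_eq_iff_eq]
      exact (hagree c hc).1.symm
    have hbc : b = c := hsc.eq_of_right hfix
    subst hbc
    exact hb (hagree b hc)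
  exact ⟨Equiv.ext fun b => (key b).1, funext fun b => (key b).2⟩

/-- **Equality from agreement on the exceptions (ceiling).**  Earlier term on the exponent ceiling off `C`, agreement on `C` ⇒ equal terms.
[this cell's law] -/
theorem eq_of_ceiling_agree (d : Fin K → ℕ) (v ε : Fin m → Fin m → Fin K → ℤ) {θ₁ θ₂ : ℤ} (hθ : θ₁ < θ₂)
    {σ₁ σ₂ : Equiv.Perm (Fin m)} {l₁ l₂ : Fin m → Fin K}
    (h₁ : IsDominant d v ε θ₁ (σ₁, l₁)) (h₂ : IsDominant d v ε θ₂ (σ₂, l₂)) (C : Finset (Fin m))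
    (hceil : ∀ b ∉ C, ∀ l : Fin K, d l ≤ d (l₁ b)) (hagree : ∀ c ∈ C, σ₁ c = σ₂ c ∧ l₁ c = l₂ c) :
    σ₁ = σ₂ ∧ l₁ = l₂ := by
  have key : ∀ b, σ₁ b = σ₂ b ∧ l₁ b = l₂ b := by
    intro b
    by_contra hb
    have hb' : σ₁ b ≠ σ₂ b ∨ l₁ b ≠ l₂ b := by
      by_cases h : σ₁ b = σ₂ b
      · exact Or.inr fun h' => hb ⟨h, h'⟩
      · exact Or.inl h
    obtain ⟨c, hc, hsc⟩ := sameCycle_of_ceiling d v ε hθ h₁ h₂ C hceil hb'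
    have hfix : Function.IsFixedPt (σ₁⁻¹ * σ₂) c := by
      show (σ₁⁻¹ * σ₂) c = c
      rw [Equiv.Perm.mul_apply, Equiv.Perm.inv_eq_iff_eq]
      exact (hagree c hc).1.symm
    have hbc : b = c := hsc.eq_of_right hfix
    subst hbc
    exact hb (hagree b hc)
  exact ⟨Equiv.ext fun b => (key b).1, funext fun b => (key b).2⟩

/-- **Fresh token (pair form).**  A dominant term on the exponent floor off the single column `c` differs from every OTHER earlier dominant
term at the column `c` itself (in row or in class). [this cell's law] -/
theorem ne_at_exception_of_floor (d : Fin K → ℕ) (v ε : Fin m → Fin m → Fin K → ℤ) {θ₁ θ₂ : ℤ} (hθ : θ₁ < θ₂)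
    {σ₁ σ₂ : Equiv.Perm (Fin m)} {l₁ l₂ : Fin m → Fin K}
    (h₁ : IsDominant d v ε θ₁ (σ₁, l₁)) (h₂ : IsDominant d v ε θ₂ (σ₂, l₂)) (c : Fin m)
    (hfloor : ∀ b, b ≠ c → ∀ l : Fin K, d (l₂ b) ≤ d l) (hne : (σ₁, l₁) ≠ (σ₂, l₂)) :
    σ₁ c ≠ σ₂ c ∨ l₁ c ≠ l₂ c := by
  by_contra hcon
  have hagree : ∀ c' ∈ ({c} : Finset (Fin m)), σ₁ c' = σ₂ c' ∧ l₁ c' = l₂ c' := by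
    intro c' hc'
    rw [Finset.mem_singleton] at hc'
    subst hc'
    by_cases h : σ₁ c' = σ₂ c'
    · exact ⟨h, by_contra fun h' => hcon (Or.inr h')⟩
    · exact absurd (Or.inl h) hcon
  obtain ⟨hσ, hl⟩ := eq_of_floor_agree d v ε hθ h₁ h₂ {c} (fun b hb => hfloor b (by simpa using hb)) hagree
  exact hne (by rw [hσ, hl])

/-- **Fresh token (pair form, ceiling dual).**  A dominant term on the exponent ceiling off the single column `c` differs from every OTHER later
dominant term at `c`. [this cell's law] -/
theorem ne_at_exception_of_ceiling (d : Fin K → ℕ) (v ε : Fin m → Fin m → Fin K → ℤ) {θ₁ θ₂ : ℤ} (hθ : θ₁ < θ₂)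
    {σ₁ σ₂ : Equiv.Perm (Fin m)} {l₁ l₂ : Fin m → Fin K}
    (h₁ : IsDominant d v ε θ₁ (σ₁, l₁)) (h₂ : IsDominant d v ε θ₂ (σ₂, l₂)) (c : Fin m)
    (hceil : ∀ b, b ≠ c → ∀ l : Fin K, d l ≤ d (l₁ b)) (hne : (σ₁, l₁) ≠ (σ₂, l₂)) :
    σ₁ c ≠ σ₂ c ∨ l₁ c ≠ l₂ c := by
  by_contra hcon
  have hagree : ∀ c' ∈ ({c} : Finset (Fin m)), σ₁ c' = σ₂ c' ∧ l₁ c' = l₂ c' := by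
    intro c' hc'
    rw [Finset.mem_singleton] at hc'
    subst hc'
    by_cases h : σ₁ c' = σ₂ c'
    · exact ⟨h, by_contra fun h' => hcon (Or.inr h')⟩
    · exact absurd (Or.inl h) hcon
  obtain ⟨hσ, hl⟩ := eq_of_ceiling_agree d v ε hθ h₁ h₂ {c} (fun b hb => hceil b (by simpa using hb)) hagree
  exact hne (by rw [hσ, hl])

/-- **Fresh token (chain form).**  In a dominant chain at strictly increasing slopes, the exceptional incidence of a floor hub at position `j`
(row `σⱼ c`, column `c`, class `λⱼ c`) is carried by no earlier term distinct from it: for `i < j` with `p i ≠ p j`,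
`σᵢ c ≠ σⱼ c ∨ λᵢ c ≠ λⱼ c`. [this cell's law] -/
theorem hub_incidence_fresh (d : Fin K → ℕ) (v ε : Fin m → Fin m → Fin K → ℤ) {n : ℕ} {θ : Fin (n + 1) → ℤ} (hθ : StrictMono θ)
    {p : Fin (n + 1) → Equiv.Perm (Fin m) × (Fin m → Fin K)} (hdom : ∀ k, IsDominant d v ε (θ k) (p k))
    {i j : Fin (n + 1)} (hij : i < j) (hne : p i ≠ p j) (c : Fin m)
    (hfloor : ∀ b, b ≠ c → ∀ l : Fin K, d ((p j).2 b) ≤ d l) :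
    (p i).1 c ≠ (p j).1 c ∨ (p i).2 c ≠ (p j).2 c :=
  ne_at_exception_of_floor d v ε (hθ hij) (σ₁ := (p i).1) (σ₂ := (p j).1) (l₁ := (p i).2) (l₂ := (p j).2)
    (hdom i) (hdom j) c hfloor (by simpa using hne)

end Summit.ValiantsHypothesis.ValiantsHypothesis.Theorems.KPlusLogSqLaw.FloorHub
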